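import Summits.BirchSwinnertonDyer.BirchSwinnertonDyer.Theorems.ManinLocalTwoThreeManinPrimeToAdditiveFiveLeRedFiveTypeIIFlipTwin
import Summits.BirchSwinnertonDyer.Rank1Residual.Additive.DictionaryUniform
import HarnessLib

/-!
# Route `ManinLocalTwoThree`, residual crux C5 `ManinPrimeToAdditiveFiveLe`
# (stmt-BirchSwinnertonDyer-22969), line `upper_anchor` (skeleton v8 → v9):
# **the unstarred `W[p]`-reducible residue at `p ∈ {5, 7}` is EXACTLY three Raynaud cells**

Lead seat bsd-line-ml23-c5-p1 (gen 5). The registered stub `stub_red57unstarredOffIIAtFive` of skeleton v8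
(`Cruxes/ManinPrimeToAdditiveFiveLe/Lines/upper_anchor.lean`, sha16 f41b6313bdbd3fbd) is Manin's `p ∤ c(D)` for
`p ∈ {5, 7}`, `W[p]` reducible (rational `p`-isogeny), `p² ∣ N(W) > 5·10⁵`, globally twist-minimal, `p ∣ deg φ`,
no `Iₙ*` fibre at `p`, `ord_p Δ_min(W) ≤ 4`, off the Kodaira-II cell at `5` (`p = 5 → ord_p Δ_min ≠ 2`),
lattice-optimal conductor-level datum `D`. By Ogg–Tate (`f_p = 2`, Silverman *ATAEC* IV Table 4.1, tree
dictionary `kodairaSymbolAt_placeOf_cases_of_addv`) its support is exactly the five cells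
`(p; ord_p Δ_min) ∈ {(5;3), (5;4), (7;2), (7;3), (7;4)}` = Kodaira `(5;III), (5;IV), (7;II), (7;III), (7;IV)`,
and the tame index `e = 12 / gcd(12, ord_p Δ_min)` (Serre–Tate, tree `semistabilityIndex`) sorts them by the
ONE hypothesis Edixhoven's 1991 proof really uses — Raynaud's `e < p − 1` (his Prop. 7: «this explains the
hypothesis p > 7») — and by potential ordinarity (`e ∣ p − 1`, his case 1 / case 2 dichotomy of §4):

| cell | `(p; ord_p Δ_min)` | Kodaira | `e` | `e < p − 1` | `e ∣ p − 1` | status in print |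
|---|---|---|---|---|---|---|
| SS57 | (5;4), (7;3) | IV at 5, III at 7 | 3, 4 | yes | NO (pot. supersingular) | Edixhoven's Props 5–8 + parity apply verbatim once `p > 7` is read as `e < p − 1`; flips in range (771, 122 rows) |
| ORD7 | (7;4) | IV at 7 | 3 | yes | yes (pot. ordinary) | Edixhoven's case 1 (`v₇(c) ≤ 1` only); commutes in range (43 rows) |
| CORNER57 | (5;3), (7;2) | III at 5, II at 7 | 4, 6 | NO (`e = p − 1`) | yes | no method in print or tree (Kosters–Pannekoek / Kummer corners); commutes in range (377, 112 rows) |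

(census: HOME `data/TWISTCENSUS2-rows-v1.tsv.gz`, `N ≤ 5·10⁵`, all `c = 1` by Cremona). This is the cut proposed by
the ideator line `Lines/raynaud-cells.md` (bsd-idea-8 g4, `stub_raynaud57` = SS57 ∪ ORD7, `stub_corner57` = CORNER57)
and by the gen-4 cell table of `LEDGER-upper-anchor.md`; the lead ADOPTS it as skeleton v9.

THIS FILE proves, kernel-checked and without any printed input:

* §1 `coreRED57unstarredOffII5_of_cells` — **`stub_red57unstarredOffIIAtFive` (v8, VERBATIM as the conclusion)
  ⟸ SS57 ∧ ORD7 ∧ CORNER57**, each cell being the v8 stub with ONE extra trailing hypothesis (the cell's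
  `(p; ord_p Δ_min)` condition). The proof is the Ogg–Tate case split: `p² ∣ N` ⇒ additive ⇒ the seven additive
  Kodaira rows; `Iₙ*` is excluded by hypothesis, the starred rows by `ord_p Δ_min ≤ 4`, `(5; II)` by hypothesis.
* §2 the Raynaud / ordinarity CERTIFICATES of the cells, so that the v9 stub docstrings are theorems and not prose:
  `semistabilityIndex_of_red57ssCell` (`e = 3` resp. `4`, `e < p − 1`, `e ∤ p − 1`), `not_typeGOrd_of_red57ssCell`
  (SS57 is OUTSIDE every (G)-ordinary statement of the tree — K★, KP57's Kummer corner, Edixhoven's case 1 — via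
  the cell dictionary `subGord_of_typeGOrd_of_addv`), `semistabilityIndex_of_red7ordCell` (`e = 3 ∣ 6`, `3 < 6`),
  `semistabilityIndex_eq_sub_one_of_red57cornerCell` (`e = p − 1`: Raynaud's bound fails by exactly one).

HONEST STATUS. Conditional result (`--supports`, helper): a re-socketing of ONE open stub into three open stubs with
pairwise different standing in print, plus elementary certificates. Nothing here proves any cell, `stub_red57unstarredOffIIAtFive`,
C5, Manin's conjecture or BSD. No summit statement is proved by this seat.

References: [EdixhovenManin1991] Thm. 3, Props. 6–9, §4 (typescript ll. 109, 395–412, 705–710);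
[SilvermanATAEC1994] IV Table 4.1; [SerreTate1968] §2 Cor. 3; [KostersPannekoek2017] Thm. 1, Cor. 2;
[Raynaud1974] Cor. 3.3.6.1.
-/

set_option autoImplicit false
-- the Theorems namespace of this sub repeats the summit name by design (D-0017 nested layout)
set_option linter.dupNamespace false

noncomputable section

open scoped Classical NumberField

namespace Summit.BirchSwinnertonDyer.BirchSwinnertonDyer.Theorems

open WeierstrassCurve IsDedekindDomain IsDedekindDomain.HeightOneSpectrum Rat.HeightOneSpectrum NumberField
  Literature.NumberTheory.EllipticCurves Literature.NumberTheory.EllipticCurves.ModularForms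
  Literature.NumberTheory.EllipticCurves.Rank1Residual
  Literature.NumberTheory.DiophantineGeometry
  Summit.BirchSwinnertonDyer.Rank1Residual.ManinAdditive
  Summit.BirchSwinnertonDyer.Rank1Residual.Additive

/-! ## §1 The reassembly: v8 anchor stub ⟸ the three Raynaud cells -/

/-- **`stub_red57unstarredOffIIAtFive` (skeleton v8, VERBATIM as the conclusion) ⟸ SS57 (`hSS`) ∧ ORD7 (`hORD`) ∧
CORNER57 (`hCORNER`).** Each hypothesis is the v8 stub with one extra trailing hypothesis: `hSS` the potentially
supersingular Raynaud-admissible cells `(p; ord_p Δ_min) ∈ {(5;4), (7;3)}` (Kodaira IV at 5, III at 7), `hORD` the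
potentially ordinary Raynaud-admissible cell `(7;4)` (Kodaira IV at 7, Edixhoven's case 1), `hCORNER` the Kummer
corners `(5;3), (7;2)` (Kodaira III at 5, II at 7; tame index `e = p − 1`). Proof: `p² ∣ N` makes `W` additive at
`p`, and the Ogg–Tate dictionary `kodairaSymbolAt_placeOf_cases_of_addv` lists the seven additive rows with their
`ord_p Δ_min`; `Iₙ*` is excluded by hypothesis, IV*, III*, II* by `ord_p Δ_min ≤ 4`, `(5;2)` by hypothesis.
Conditional result between OPEN statements; nothing here proves C5. [cite: SilvermanATAEC1994, IV Table 4.1]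
[cite: EdixhovenManin1991, Thm. 3 and Prop. 7] -/
theorem coreRED57unstarredOffII5_of_cells
    (hSS : mazur_not_dvd_maninConstant_of_odd → abbesUllmo_not_dvd_maninConstant_of_not_dvd_level →
      cesnavicius_not_two_dvd_maninConstant_of_two_dvd_level → exists_isNewformOf →
      ∀ (W : WeierstrassCurve ℚ) [W.IsElliptic] [W.IsGloballyMinimal] [NeZero (W.conductorNorm ℤ)]
        (D : ModularParametrizationData W (W.conductorNorm ℤ)),
        IsLatticeOptimal D → ∀ (p : ℕ) (hp : p.Prime), (p = 5 ∨ p = 7) → p ^ 2 ∣ W.conductorNorm ℤ →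
        ¬ (∃ (W' : WeierstrassCurve ℚ) (q : ℕ), W'.IsElliptic ∧ W'.IsGloballyMinimal ∧ q.Prime ∧
            q ≠ 2 ∧ q ^ 2 ∣ W.conductorNorm ℤ ∧
            IsIsogenous W (W'.quadraticTwist (((-1 : ℤ) ^ (q / 2) * q : ℤ) : ℚ)) ∧
            ¬ q ^ 2 ∣ W'.conductorNorm ℤ) →
        ¬ (∃ (W' : WeierstrassCurve ℚ) (d : ℤ), W'.IsElliptic ∧ W'.IsGloballyMinimal ∧
            (d = -1 ∨ d = 2 ∨ d = -2) ∧ 2 ^ 2 ∣ W.conductorNorm ℤ ∧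
            IsIsogenous W (W'.quadraticTwist (d : ℚ)) ∧ ¬ 2 ^ 2 ∣ W'.conductorNorm ℤ) →
        ¬ W.HasIrreducibleModPGaloisRep p →
        500000 < W.conductorNorm ℤ →
        p ∣ D.modularDegree →
        (∀ n : ℕ, W.kodairaSymbolAt ((Rat.HeightOneSpectrum.primesEquiv (R := ℤ)).symm ⟨p, hp⟩) ≠
          .Istar n) →
        padicValInt p W.minimalDiscriminantInt ≤ 4 →
        (p = 5 → padicValInt p W.minimalDiscriminantInt ≠ 2) →
        ((p = 5 ∧ padicValInt p W.minimalDiscriminantInt = 4) ∨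
          (p = 7 ∧ padicValInt p W.minimalDiscriminantInt = 3)) →
        ¬ (p : ℤ) ∣ D.maninConstant)
    (hORD : mazur_not_dvd_maninConstant_of_odd → abbesUllmo_not_dvd_maninConstant_of_not_dvd_level →
      cesnavicius_not_two_dvd_maninConstant_of_two_dvd_level → exists_isNewformOf →
      ∀ (W : WeierstrassCurve ℚ) [W.IsElliptic] [W.IsGloballyMinimal] [NeZero (W.conductorNorm ℤ)]
        (D : ModularParametrizationData W (W.conductorNorm ℤ)),
        IsLatticeOptimal D → ∀ (p : ℕ) (hp : p.Prime), (p = 5 ∨ p = 7) → p ^ 2 ∣ W.conductorNorm ℤ →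
        ¬ (∃ (W' : WeierstrassCurve ℚ) (q : ℕ), W'.IsElliptic ∧ W'.IsGloballyMinimal ∧ q.Prime ∧
            q ≠ 2 ∧ q ^ 2 ∣ W.conductorNorm ℤ ∧
            IsIsogenous W (W'.quadraticTwist (((-1 : ℤ) ^ (q / 2) * q : ℤ) : ℚ)) ∧
            ¬ q ^ 2 ∣ W'.conductorNorm ℤ) →
        ¬ (∃ (W' : WeierstrassCurve ℚ) (d : ℤ), W'.IsElliptic ∧ W'.IsGloballyMinimal ∧
            (d = -1 ∨ d = 2 ∨ d = -2) ∧ 2 ^ 2 ∣ W.conductorNorm ℤ ∧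
            IsIsogenous W (W'.quadraticTwist (d : ℚ)) ∧ ¬ 2 ^ 2 ∣ W'.conductorNorm ℤ) →
        ¬ W.HasIrreducibleModPGaloisRep p →
        500000 < W.conductorNorm ℤ →
        p ∣ D.modularDegree →
        (∀ n : ℕ, W.kodairaSymbolAt ((Rat.HeightOneSpectrum.primesEquiv (R := ℤ)).symm ⟨p, hp⟩) ≠
          .Istar n) →
        padicValInt p W.minimalDiscriminantInt ≤ 4 →
        (p = 5 → padicValInt p W.minimalDiscriminantInt ≠ 2) →
        p = 7 → padicValInt p W.minimalDiscriminantInt = 4 →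
        ¬ (p : ℤ) ∣ D.maninConstant)
    (hCORNER : mazur_not_dvd_maninConstant_of_odd → abbesUllmo_not_dvd_maninConstant_of_not_dvd_level →
      cesnavicius_not_two_dvd_maninConstant_of_two_dvd_level → exists_isNewformOf →
      ∀ (W : WeierstrassCurve ℚ) [W.IsElliptic] [W.IsGloballyMinimal] [NeZero (W.conductorNorm ℤ)]
        (D : ModularParametrizationData W (W.conductorNorm ℤ)),
        IsLatticeOptimal D → ∀ (p : ℕ) (hp : p.Prime), (p = 5 ∨ p = 7) → p ^ 2 ∣ W.conductorNorm ℤ →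
        ¬ (∃ (W' : WeierstrassCurve ℚ) (q : ℕ), W'.IsElliptic ∧ W'.IsGloballyMinimal ∧ q.Prime ∧
            q ≠ 2 ∧ q ^ 2 ∣ W.conductorNorm ℤ ∧
            IsIsogenous W (W'.quadraticTwist (((-1 : ℤ) ^ (q / 2) * q : ℤ) : ℚ)) ∧
            ¬ q ^ 2 ∣ W'.conductorNorm ℤ) →
        ¬ (∃ (W' : WeierstrassCurve ℚ) (d : ℤ), W'.IsElliptic ∧ W'.IsGloballyMinimal ∧
            (d = -1 ∨ d = 2 ∨ d = -2) ∧ 2 ^ 2 ∣ W.conductorNorm ℤ ∧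
            IsIsogenous W (W'.quadraticTwist (d : ℚ)) ∧ ¬ 2 ^ 2 ∣ W'.conductorNorm ℤ) →
        ¬ W.HasIrreducibleModPGaloisRep p →
        500000 < W.conductorNorm ℤ →
        p ∣ D.modularDegree →
        (∀ n : ℕ, W.kodairaSymbolAt ((Rat.HeightOneSpectrum.primesEquiv (R := ℤ)).symm ⟨p, hp⟩) ≠
          .Istar n) →
        padicValInt p W.minimalDiscriminantInt ≤ 4 →
        (p = 5 → padicValInt p W.minimalDiscriminantInt ≠ 2) →
        ((p = 5 ∧ padicValInt p W.minimalDiscriminantInt = 3) ∨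
          (p = 7 ∧ padicValInt p W.minimalDiscriminantInt = 2)) →
        ¬ (p : ℤ) ∣ D.maninConstant) :
    mazur_not_dvd_maninConstant_of_odd → abbesUllmo_not_dvd_maninConstant_of_not_dvd_level →
    cesnavicius_not_two_dvd_maninConstant_of_two_dvd_level → exists_isNewformOf →
    ∀ (W : WeierstrassCurve ℚ) [W.IsElliptic] [W.IsGloballyMinimal] [NeZero (W.conductorNorm ℤ)]
      (D : ModularParametrizationData W (W.conductorNorm ℤ)),
      IsLatticeOptimal D → ∀ (p : ℕ) (hp : p.Prime), (p = 5 ∨ p = 7) → p ^ 2 ∣ W.conductorNorm ℤ →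
      ¬ (∃ (W' : WeierstrassCurve ℚ) (q : ℕ), W'.IsElliptic ∧ W'.IsGloballyMinimal ∧ q.Prime ∧
          q ≠ 2 ∧ q ^ 2 ∣ W.conductorNorm ℤ ∧
          IsIsogenous W (W'.quadraticTwist (((-1 : ℤ) ^ (q / 2) * q : ℤ) : ℚ)) ∧
          ¬ q ^ 2 ∣ W'.conductorNorm ℤ) →
      ¬ (∃ (W' : WeierstrassCurve ℚ) (d : ℤ), W'.IsElliptic ∧ W'.IsGloballyMinimal ∧
          (d = -1 ∨ d = 2 ∨ d = -2) ∧ 2 ^ 2 ∣ W.conductorNorm ℤ ∧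
          IsIsogenous W (W'.quadraticTwist (d : ℚ)) ∧ ¬ 2 ^ 2 ∣ W'.conductorNorm ℤ) →
      ¬ W.HasIrreducibleModPGaloisRep p →
      500000 < W.conductorNorm ℤ →
      p ∣ D.modularDegree →
      (∀ n : ℕ, W.kodairaSymbolAt ((Rat.HeightOneSpectrum.primesEquiv (R := ℤ)).symm ⟨p, hp⟩) ≠
        .Istar n) →
      padicValInt p W.minimalDiscriminantInt ≤ 4 →
      (p = 5 → padicValInt p W.minimalDiscriminantInt ≠ 2) →
      ¬ (p : ℤ) ∣ D.maninConstant := by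
  intro hM hAU hC hnf W _ _ _ D hD p hp h57 hpN hodd hdy hred hN hdeg hI hv h52
  haveI hpF : Fact p.Prime := ⟨hp⟩
  have h5 : 5 ≤ p := by omega
  have hadd : Addv W p := not_good_and_not_mult_of_sq_dvd_conductorNorm W hpN
  -- Ogg–Tate: the seven additive Kodaira rows with their `ord_p Δ_min`
  rcases kodairaSymbolAt_placeOf_cases_of_addv W p h5 hadd with
    ⟨-, h2⟩ | ⟨-, h3⟩ | ⟨-, h4⟩ | ⟨m, hm, -⟩ | ⟨-, h8⟩ | ⟨-, h9⟩ | ⟨-, h10⟩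
  · -- Kodaira II: excluded at `5`, the corner `(7;2)` at `7`
    rcases id h57 with h | h
    · exact absurd h2 (h52 h)
    · exact hCORNER hM hAU hC hnf W D hD p hp h57 hpN hodd hdy hred hN hdeg hI hv h52 (Or.inr ⟨h, h2⟩)
  · -- Kodaira III: the corner `(5;3)` at `5`, the SS cell `(7;3)` at `7`
    rcases id h57 with h | h
    · exact hCORNER hM hAU hC hnf W D hD p hp h57 hpN hodd hdy hred hN hdeg hI hv h52 (Or.inl ⟨h, h3⟩)
    · exact hSS hM hAU hC hnf W D hD p hp h57 hpN hodd hdy hred hN hdeg hI hv h52 (Or.inr ⟨h, h3⟩)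
  · -- Kodaira IV: the SS cell `(5;4)` at `5`, the ORD cell `(7;4)` at `7`
    rcases id h57 with h | h
    · exact hSS hM hAU hC hnf W D hD p hp h57 hpN hodd hdy hred hN hdeg hI hv h52 (Or.inl ⟨h, h4⟩)
    · exact hORD hM hAU hC hnf W D hD p hp h57 hpN hodd hdy hred hN hdeg hI hv h52 h h4
  · -- `Iₙ*`: excluded by hypothesis
    exact absurd hm (hI m)
  · omega
  · omega
  · omega

/-! ## §2 Certificates: tame index, Raynaud admissibility and (non-)ordinarity of the three cells -/

/-- **SS57 has tame index `e = 3` at `(5; IV)` and `e = 4` at `(7; III)`; in both cases `e < p − 1` (Raynaud's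
hypothesis of Edixhoven's Prop. 7 HOLDS) and `e ∤ p − 1` (the cell is potentially SUPERSINGULAR).**
Pure arithmetic on the tree's `semistabilityIndex W p = 12 / gcd(12, ord_p Δ_min)` (Serre–Tate).
[cite: SerreTate1968, §2 Cor. 3] [cite: EdixhovenManin1991, Prop. 7] -/
theorem semistabilityIndex_of_red57ssCell (W : WeierstrassCurve ℚ) [W.IsElliptic] [W.IsGloballyMinimal]
    (p : ℕ) [Fact p.Prime]
    (hcell : (p = 5 ∧ padicValInt p W.minimalDiscriminantInt = 4) ∨
      (p = 7 ∧ padicValInt p W.minimalDiscriminantInt = 3)) :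
    ((p = 5 ∧ semistabilityIndex W p = 3) ∨ (p = 7 ∧ semistabilityIndex W p = 4)) ∧
      semistabilityIndex W p < p - 1 ∧ ¬ semistabilityIndex W p ∣ p - 1 := by
  unfold semistabilityIndex
  rcases hcell with ⟨rfl, hv⟩ | ⟨rfl, hv⟩ <;> rw [hv] <;> decide

/-- **SS57 is outside every (G)-ordinary statement**: on the cell `(5; IV) ∪ (7; III)` the predicate `TypeGOrd W p`
(«potentially good ORDINARY over a subfield of `ℚ(μ_p)`», the standing hypothesis of K★ / KP57's Kummer corner /
Edixhoven's case 1) FAILS, because (G) forces `e ∣ p − 1` (cell dictionary `subGord_of_typeGOrd_of_addv`) while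
`e ∈ {3 at 5, 4 at 7}`. Hence no (G)-ordinary item of the tree can ever absorb SS57; its printed mechanism is
Edixhoven's parity argument for potentially supersingular reduction (typescript ll. 705–708).
[cite: EdixhovenManin1991, §4 (last paragraph)] [cite: SerreTate1968, §2 Cor. 3] -/
theorem not_typeGOrd_of_red57ssCell (W : WeierstrassCurve ℚ) [W.IsElliptic] [W.IsGloballyMinimal]
    (p : ℕ) [Fact p.Prime] (hadd : Addv W p)
    (hcell : (p = 5 ∧ padicValInt p W.minimalDiscriminantInt = 4) ∨
      (p = 7 ∧ padicValInt p W.minimalDiscriminantInt = 3)) :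
    ¬ TypeGOrd W p := by
  intro hG
  have hp2 : p ≠ 2 := by rcases hcell with ⟨rfl, -⟩ | ⟨rfl, -⟩ <;> decide
  have hdvd : semistabilityIndex W p ∣ p - 1 := (subGord_of_typeGOrd_of_addv W p hp2 hG hadd).2.2
  exact (semistabilityIndex_of_red57ssCell W p hcell).2.2 hdvd

/-- **ORD7 has tame index `e = 3` at `(7; IV)`: `e < p − 1 = 6` (Raynaud-admissible) and `e ∣ p − 1` (potentially
ORDINARY — Edixhoven's case 1 / case 2 dichotomy, where his method proves only `v₇(c) ≤ 1`).**
[cite: EdixhovenManin1991, Thm. 3 and §4] [cite: SerreTate1968, §2 Cor. 3] -/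
theorem semistabilityIndex_of_red7ordCell (W : WeierstrassCurve ℚ) [W.IsElliptic] [W.IsGloballyMinimal]
    (p : ℕ) [Fact p.Prime] (hp7 : p = 7) (hv : padicValInt p W.minimalDiscriminantInt = 4) :
    semistabilityIndex W p = 3 ∧ semistabilityIndex W p < p - 1 ∧ semistabilityIndex W p ∣ p - 1 := by
  unfold semistabilityIndex
  subst hp7
  rw [hv]
  decide

/-- **CORNER57 has tame index `e = p − 1`** (`e = 4` at `(5; III)`, `e = 6` at `(7; II)`): Raynaud's bound
`e < p − 1` fails by exactly one — the Kosters–Pannekoek / Kummer corners, where neither Edixhoven's method nor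
the nebentypus descent has a foothold, and the Kato lever needs `W[p]` irreducible. [cite: KostersPannekoek2017, Thm. 1]
[cite: EdixhovenManin1991, Prop. 7] -/
theorem semistabilityIndex_eq_sub_one_of_red57cornerCell (W : WeierstrassCurve ℚ) [W.IsElliptic]
    [W.IsGloballyMinimal] (p : ℕ) [Fact p.Prime]
    (hcell : (p = 5 ∧ padicValInt p W.minimalDiscriminantInt = 3) ∨
      (p = 7 ∧ padicValInt p W.minimalDiscriminantInt = 2)) :
    semistabilityIndex W p = p - 1 ∧ semistabilityIndex W p ∣ p - 1 := by
  unfold semistabilityIndex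
  rcases hcell with ⟨rfl, hv⟩ | ⟨rfl, hv⟩ <;> rw [hv] <;> decide

end Summit.BirchSwinnertonDyer.BirchSwinnertonDyer.Theorems

end
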